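import Summits.CriticalPhenomena.PercolationContinuityZ3.Theorems.PercLowPointHalfSpaceQuantitativeBGNWallTwoGhostExplore
import HarnessLib

/-!
# `QuantitativeBGN` (stmt-CriticalPhenomena-0913), line `longrange-wall-ghost-bootstrap` — K1, bond coefficients

Part of the stub `stub_wallTwoGhost` (K1, basic two-ghost inequality on the wall; template
`Literature/Probability/Percolation/TwoGhostInequalityProofs.lean`). The wall-bond martingale scores the
query of a pair `e` by `κ(e)(ω_e - w_e)` with the bond coefficient `κ(e) = Σ_{x∈s} c_x lab(e, x)`,
`lab(e, x) ∈ {0,1}` the number of wall vertices `u` with `e = {u, u + x}` (weights `c` on the finite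
type set `s`). This file provides (namespace `…Theorems.WallTwoGhost`):

* generic complements on the exploration (`proc_eq_sum_stepVal`, every queried edge has an endpoint in
  the previous active set, the run only reads edges of the step graph `run_inter_edgeSet`);
* `lab`, `kap` and their elementary properties, the exchange of summation
  `Σ_e κ(e) g(e) = Σ_x c_x Σ_u g({u,u+x})` (`sum_kap_mul_eq`);
* the variance constant `Vc = Σ_{x∈s} c_x² q_x` and **the per-vertex bound**
  `Σ_{v ∼ u} κ({u,v})² w({u,v}) ≤ 4 V_c` at a wall vertex `u` of the truncated step graph `trG L`
  (`star_bound`, registered as `wallTwoGhost_star_bound`);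
* the degree bound `deg_{trG L} ≤ 6 + (2L+1)³` and `|E_{trG L}(K)| ≤ |K| (6 + (2L+1)³)`.
-/

noncomputable section

namespace Summit.CriticalPhenomena.PercolationContinuityZ3.Theorems

open MeasureTheory Filter Literature.Probability.Percolation Literature.Probability.LatticeModels
open Summit.CriticalPhenomena.PercolationContinuityZ3.Theorems.WallGhost
open scoped ENNReal

namespace WallTwoGhost
/-! ### More on the exploration: sums along the run, reading only the step graph -/

section ExploreMore

open ClusterExploration

open Classical in
/-- **The transform as a sum over the history**: if, along the run of `ω`, every increment made is
`ψ(edge, answer)` for a fixed `ψ`, then `S_k(ω) = Σ_{(e,b) ∈ hist(run_k ω)} ψ(e, b)`. [folklore] -/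
theorem proc_eq_sum_hist {V : Type*} [DecidableEq V] {G : SimpleGraph V} [G.LocallyFinite] {n : ℕ}
    {Φ : State V → Bool → ℝ} (ψ : Sym2 V → Bool → ℝ) (o : V) (ω : Set (Sym2 V)) :
    ∀ k, (∀ j < k, ∀ (h : ¬ Halted G n (run G n o ω j)) (b : Bool),
        Φ (run G n o ω j) b = ψ (nextEdge G n (run G n o ω j) h) b) →
      proc G n Φ o k ω = ((run G n o ω k).hist.map fun eb => ψ eb.1 eb.2).sum
  | 0, _ => by simp [proc, init]
  | k + 1, hyp => by
    have ih := proc_eq_sum_hist ψ o ω k fun j hj => hyp j (Nat.lt_succ_of_lt hj)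
    simp only [proc]
    rw [ih, run_succ]
    by_cases hH : Halted G n (run G n o ω k)
    · rw [step_of_halted hH, stepVal, dif_pos hH, add_zero]
    · rw [step_of_not_halted hH, stepVal, dif_neg hH, hist_extend, List.map_append, List.sum_append,
        hyp k (Nat.lt_succ_self k) hH]
      simp

/-- `S_k` is the sum of its increments. [folklore] -/
theorem proc_eq_sum_stepVal {V : Type*} [DecidableEq V] {G : SimpleGraph V} [G.LocallyFinite] {n : ℕ}
    (Φ : State V → Bool → ℝ) (o : V) (ω : Set (Sym2 V)) :
    ∀ k, proc G n Φ o k ω = ∑ j ∈ Finset.range k, stepVal G n Φ o j ω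
  | 0 => by simp [proc]
  | k + 1 => by rw [Finset.sum_range_succ, ← proc_eq_sum_stepVal Φ o ω k]; rfl

/-- Every queried edge after `k + 1` steps has an endpoint in the active set at time `k`. [folklore] -/
theorem exists_mem_A_of_mem_queried {V : Type*} [DecidableEq V] {G : SimpleGraph V} [G.LocallyFinite]
    {n : ℕ} (o : V) (ω : Set (Sym2 V)) (k : ℕ) :
    ∀ e ∈ queried (run G n o ω (k + 1)), ∃ u ∈ (run G n o ω k).A, u ∈ e := by
  intro e he
  rw [run_succ] at he
  by_cases h : Halted G n (run G n o ω k)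
  · rw [step_of_halted h] at he
    exact ((inv_run o ω k).queried_spec e he).2
  · rw [step_of_not_halted h, queried, hist_extend, List.map_append, List.toFinset_append, Finset.mem_union] at he
    rcases he with he | he
    · exact ((inv_run o ω k).queried_spec e he).2
    · simp only [List.map_cons, List.map_nil, List.toFinset_cons, List.toFinset_nil, insert_empty_eq,
        Finset.mem_singleton] at he
      obtain ⟨⟨u, hu, v, -, huv⟩, -⟩ := nextEdge_spec h
      exact ⟨u, hu, by rw [he, ← huv]; exact Sym2.mem_mk_left u v⟩

/-- Sums of nonnegative terms over a union are at most the sum of the sums. [folklore] -/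
theorem sum_biUnion_le_sum {ι β : Type*} [DecidableEq β] (S : Finset ι) (t : ι → Finset β) {f : β → ℝ}
    (hf : ∀ x, 0 ≤ f x) : ∑ x ∈ S.biUnion t, f x ≤ ∑ a ∈ S, ∑ x ∈ t a, f x := by
  classical
  induction S using Finset.induction_on with
  | empty => simp
  | insert a S ha ih =>
    rw [Finset.biUnion_insert, Finset.sum_insert ha]
    calc ∑ x ∈ t a ∪ S.biUnion t, f x ≤ ∑ x ∈ t a, f x + ∑ x ∈ S.biUnion t, f x := by
          rw [← Finset.sum_union_inter]
          exact le_add_of_nonneg_right (Finset.sum_nonneg fun x _ => hf x)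
      _ ≤ ∑ x ∈ t a, f x + ∑ a ∈ S, ∑ x ∈ t a, f x := add_le_add le_rfl ih

/-- **The run only reads edges of the step graph**: restricting the configuration to `E(G)` does not
change it. [folklore] -/
theorem run_inter_edgeSet {V : Type*} [DecidableEq V] {G : SimpleGraph V} [G.LocallyFinite] {n : ℕ}
    (o : V) (ω : Set (Sym2 V)) (k : ℕ) : run G n o (ω ∩ G.edgeSet) k = run G n o ω k := by
  refine run_congr o k (fun eb heb => ?_)
  have hq : eb.1 ∈ queried (run G n o ω k) := mem_queried_iff.2 ⟨eb.2, heb⟩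
  have hE := ((inv_run (G := G) (n := n) o ω k).queried_spec eb.1 hq).1
  rw [Set.mem_inter_iff]
  exact ⟨fun h => (mem_cyl_run o ω k eb heb).1 h.1, fun h => ⟨(mem_cyl_run o ω k eb heb).2 h, hE⟩⟩

end ExploreMore

/-! ### Labels of wall bonds, bond coefficients, and the per-vertex variance bound -/

/-- The map `u ↦ {u, u + x}` is injective (in `ℤ³`, `2x = 0` forces `x = 0`). [folklore] -/
theorem mk_add_injective (x : Site 3) : Function.Injective fun u : Site 3 => s(u, u + x) := by
  intro u v h
  rcases Sym2.eq_iff.1 h with ⟨h, -⟩ | ⟨h1, h2⟩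
  · exact h
  · have hx : x + x = 0 := by
      rw [h1, add_assoc] at h2
      exact add_left_cancel (h2.trans (add_zero v).symm)
    have hx0 : x = 0 := by
      funext i
      have := congrFun hx i
      simp only [Pi.add_apply, Pi.zero_apply] at this
      change x i = 0
      omega
    rw [h1, hx0, add_zero]

/-- `lab e x`: the number (`0` or `1`) of wall vertices `u` naming the pair `e` as the bond `{u, u + x}`
of type `x`. [folklore] -/
def lab (e : Sym2 (Site 3)) (x : Site 3) : ℕ := {u : Site 3 | u 0 = 0 ∧ s(u, u + x) = e}.ncard

/-- The label set of a pair is a subsingleton. [folklore] -/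
theorem lab_subsingleton (e : Sym2 (Site 3)) (x : Site 3) :
    ({u : Site 3 | u 0 = 0 ∧ s(u, u + x) = e}).Subsingleton :=
  fun _ hu _ hv => mk_add_injective x (hu.2.trans hv.2.symm)

/-- `lab ≤ 1`. [folklore] -/
theorem lab_le_one (e : Sym2 (Site 3)) (x : Site 3) : lab e x ≤ 1 := by
  haveI := (lab_subsingleton e x).finite.to_subtype
  rw [lab, Set.ncard_le_one_iff_subsingleton]
  exact lab_subsingleton e x

/-- The bond `{u, u + x}` at a wall vertex `u` has exactly one label of type `x`. [folklore] -/
theorem lab_mk_add {u x : Site 3} (hu : u 0 = 0) : lab s(u, u + x) x = 1 := by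
  rw [lab, Set.ncard_eq_one]
  refine ⟨u, Set.Subset.antisymm (fun v hv => ?_) ?_⟩
  · exact mk_add_injective x hv.2
  · rintro v rfl; exact ⟨hu, rfl⟩

/-- A pair that is not of the form `{u, u + x}` (`u ∈ ∂H`) has no label of type `x`. [folklore] -/
theorem lab_eq_zero {e : Sym2 (Site 3)} {x : Site 3} (h : ∀ u : Site 3, u 0 = 0 → s(u, u + x) ≠ e) :
    lab e x = 0 := by
  have : {u : Site 3 | u 0 = 0 ∧ s(u, u + x) = e} = ∅ :=
    Set.eq_empty_of_forall_notMem fun u hu => h u hu.1 hu.2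
  rw [lab, this, Set.ncard_empty]

/-- The labels of a concrete pair `{a, b}` of type `x`: at most `[b = a + x] + [a = b + x]`. [folklore] -/
theorem lab_mk_le (a b x : Site 3) :
    (lab s(a, b) x : ℝ) ≤ (if b = a + x then 1 else 0) + (if a = b + x then 1 else 0) := by
  by_cases h : ∃ u : Site 3, u 0 = 0 ∧ s(u, u + x) = s(a, b)
  · obtain ⟨u, -, hu⟩ := h
    have h1 : (lab s(a, b) x : ℝ) ≤ 1 := by exact_mod_cast lab_le_one _ _
    rcases Sym2.eq_iff.1 hu with ⟨rfl, h2⟩ | ⟨rfl, h2⟩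
    · rw [if_pos h2.symm]; split_ifs <;> linarith
    · rw [if_pos h2.symm]; split_ifs <;> linarith
  · push Not at h
    rw [lab_eq_zero h]; push_cast
    split_ifs <;> linarith

/-- **The bond coefficient** `κ(e) = Σ_{x∈s} c_x lab(e, x)` of the wall-bond martingale with weights `c`
on the type set `s`. [cite: Hutchcroft2020Locality, §3, proof of Thm. 1.6] -/
def kap (c : Site 3 → ℝ) (s : Finset (Site 3)) (e : Sym2 (Site 3)) : ℝ := ∑ x ∈ s, c x * lab e x

/-- `0 ≤ κ` for nonnegative weights. [folklore] -/
theorem kap_nonneg {c : Site 3 → ℝ} {s : Finset (Site 3)} (hc : ∀ x ∈ s, 0 ≤ c x) (e : Sym2 (Site 3)) :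
    0 ≤ kap c s e :=
  Finset.sum_nonneg fun x hx => mul_nonneg (hc x hx) (Nat.cast_nonneg _)

/-- `|κ| ≤ Σ_{x∈s} |c_x|`. [folklore] -/
theorem abs_kap_le (c : Site 3 → ℝ) (s : Finset (Site 3)) (e : Sym2 (Site 3)) :
    |kap c s e| ≤ ∑ x ∈ s, |c x| := by
  refine (Finset.abs_sum_le_sum_abs _ _).trans (Finset.sum_le_sum fun x _ => ?_)
  rw [abs_mul, Nat.abs_cast]
  have : (lab e x : ℝ) ≤ 1 := by exact_mod_cast lab_le_one e x
  nlinarith [abs_nonneg (c x), (Nat.cast_nonneg (lab e x) : (0 : ℝ) ≤ lab e x)]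

/-- A pair with a label of a wall type has both endpoints on the wall; in particular `κ(e) ≠ 0`
forces every endpoint of `e` onto the wall. [folklore] -/
theorem wall_of_kap_ne_zero {c : Site 3 → ℝ} {s : Finset (Site 3)} (hs : ∀ x ∈ s, x 0 = 0)
    {e : Sym2 (Site 3)} (h : kap c s e ≠ 0) {v : Site 3} (hv : v ∈ e) : v 0 = 0 := by
  obtain ⟨x, hx, hne⟩ := Finset.exists_ne_zero_of_sum_ne_zero h
  have hl : lab e x ≠ 0 := fun h0 => hne (by rw [h0]; simp)
  by_contra hv0
  refine hl (lab_eq_zero fun u hu hue => ?_)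
  rw [← hue, Sym2.mem_iff] at hv
  rcases hv with rfl | rfl
  · exact hv0 hu
  · exact hv0 (by simp [hu, hs x hx])

/-- **Exchange of summation**: summing `κ(e) g(e)` over a finite set of pairs is summing `c_x g({u,u+x})`
over types `x` and wall labels `u`. [folklore] -/
theorem sum_kap_mul_eq (c : Site 3 → ℝ) (s : Finset (Site 3)) (ET : Finset (Sym2 (Site 3)))
    (g : Sym2 (Site 3) → ℝ) (U : Site 3 → Finset (Site 3))
    (hU : ∀ x ∈ s, ∀ u, u ∈ U x ↔ u 0 = 0 ∧ s(u, u + x) ∈ ET) :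
    ∑ e ∈ ET, kap c s e * g e = ∑ x ∈ s, c x * ∑ u ∈ U x, g s(u, u + x) := by
  classical
  simp only [kap, Finset.sum_mul]
  rw [Finset.sum_comm]
  refine Finset.sum_congr rfl fun x hx => ?_
  simp only [mul_assoc, ← Finset.mul_sum]
  congr 1
  have hmaps : ∀ u ∈ U x, s(u, u + x) ∈ ET := fun u hu => ((hU x hx u).1 hu).2
  rw [← Finset.sum_fiberwise_of_maps_to hmaps]
  refine Finset.sum_congr rfl fun e he => ?_
  have hset : {u : Site 3 | u 0 = 0 ∧ s(u, u + x) = e} = ↑((U x).filter fun u => s(u, u + x) = e) := by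
    ext u
    simp only [Set.mem_setOf_eq, Finset.coe_filter, hU x hx u]
    constructor
    · rintro ⟨hu, hue⟩; exact ⟨⟨hu, hue ▸ he⟩, hue⟩
    · rintro ⟨⟨hu, -⟩, hue⟩; exact ⟨hu, hue⟩
  rw [lab, hset, Set.ncard_coe_finset, Finset.sum_filter]
  rw [Finset.sum_congr rfl (g := fun u => if s(u, u + x) = e then g e else 0) fun u _ => by
    split_ifs with h
    · rw [h]
    · rfl]
  rw [← Finset.sum_filter, Finset.sum_const, nsmul_eq_mul]

/-- The variance constant `V_c = Σ_{x∈s} c_x² q_x`. [cite: Hutchcroft2020Locality, §3, proof of Thm. 1.6] -/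
def Vc (p : unitInterval) (lam α : ℝ) (c : Site 3 → ℝ) (s : Finset (Site 3)) : ℝ :=
  ∑ x ∈ s, c x ^ 2 * wallBondProb p lam α x

/-- `0 ≤ V_c`. [folklore] -/
theorem Vc_nonneg (p : unitInterval) (lam α : ℝ) (c : Site 3 → ℝ) (s : Finset (Site 3)) : 0 ≤ Vc p lam α c s :=
  Finset.sum_nonneg fun x _ => mul_nonneg (sq_nonneg _) (wallBondProb_mem p lam α x).1

/-- One half of the star bound: `Σ_{v ∼ u} [v - u ∈ s] c_{v-u}² w({u,v}) ≤ V_c` at a wall vertex `u`. [folklore] -/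
theorem sum_nbr_sq_le (p : unitInterval) (lam α : ℝ) (c : Site 3 → ℝ) (s : Finset (Site 3)) (L : ℕ)
    {u : Site 3} (hu : u 0 = 0) :
    ∑ v ∈ (trG L).neighborFinset u, (if v - u ∈ s then c (v - u) ^ 2 else 0) * (augProb p lam α s(u, v) : ℝ) ≤
      Vc p lam α c s := by
  classical
  rw [← Finset.sum_filter_of_ne (p := fun v => v - u ∈ s) (fun v _ h => by
    contrapose! h; simp [h])]
  have hinj : Set.InjOn (fun v : Site 3 => v - u) ↑(((trG L).neighborFinset u).filter fun v => v - u ∈ s) :=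
    fun a _ b _ h => sub_left_injective h
  calc ∑ v ∈ ((trG L).neighborFinset u).filter (fun v => v - u ∈ s),
        (if v - u ∈ s then c (v - u) ^ 2 else 0) * (augProb p lam α s(u, v) : ℝ)
      = ∑ v ∈ ((trG L).neighborFinset u).filter (fun v => v - u ∈ s),
          c (v - u) ^ 2 * wallBondProb p lam α (v - u) := by
        refine Finset.sum_congr rfl fun v hv => ?_
        rw [Finset.mem_filter] at hv
        rw [if_pos hv.2, wallBondProb, ← augProb_mk_add p lam α hu (v - u), add_sub_cancel]
    _ = ∑ x ∈ (((trG L).neighborFinset u).filter fun v => v - u ∈ s).image (fun v => v - u),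
          c x ^ 2 * wallBondProb p lam α x :=
        (Finset.sum_image (f := fun x => c x ^ 2 * wallBondProb p lam α x) hinj).symm
    _ ≤ Vc p lam α c s := by
        refine Finset.sum_le_sum_of_subset_of_nonneg (fun x hx => ?_) fun x _ _ =>
          mul_nonneg (sq_nonneg _) (wallBondProb_mem p lam α x).1
        obtain ⟨v, hv, rfl⟩ := Finset.mem_image.1 hx
        exact (Finset.mem_filter.1 hv).2

/-- The other half: `Σ_{v ∼ u} [u - v ∈ s] c_{u-v}² w({u,v}) ≤ V_c` (types `s ⊆ ∂H`). [folklore] -/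
theorem sum_nbr_sq_le' (p : unitInterval) (lam α : ℝ) (c : Site 3 → ℝ) {s : Finset (Site 3)}
    (hs : ∀ x ∈ s, x 0 = 0) (L : ℕ) {u : Site 3} (hu : u 0 = 0) :
    ∑ v ∈ (trG L).neighborFinset u, (if u - v ∈ s then c (u - v) ^ 2 else 0) * (augProb p lam α s(u, v) : ℝ) ≤
      Vc p lam α c s := by
  classical
  rw [← Finset.sum_filter_of_ne (p := fun v => u - v ∈ s) (fun v _ h => by
    contrapose! h; simp [h])]
  have hinj : Set.InjOn (fun v : Site 3 => u - v) ↑(((trG L).neighborFinset u).filter fun v => u - v ∈ s) :=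
    fun a _ b _ h => sub_right_injective h
  calc ∑ v ∈ ((trG L).neighborFinset u).filter (fun v => u - v ∈ s),
        (if u - v ∈ s then c (u - v) ^ 2 else 0) * (augProb p lam α s(u, v) : ℝ)
      = ∑ v ∈ ((trG L).neighborFinset u).filter (fun v => u - v ∈ s),
          c (u - v) ^ 2 * wallBondProb p lam α (u - v) := by
        refine Finset.sum_congr rfl fun v hv => ?_
        rw [Finset.mem_filter] at hv
        have hv0 : v 0 = 0 := by
          have := hs _ hv.2
          simp only [Pi.sub_apply, hu] at this
          omega
        rw [if_pos hv.2, wallBondProb, ← augProb_mk_add p lam α hv0 (u - v), add_sub_cancel, Sym2.eq_swap]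
    _ = ∑ x ∈ (((trG L).neighborFinset u).filter fun v => u - v ∈ s).image (fun v => u - v),
          c x ^ 2 * wallBondProb p lam α x :=
        (Finset.sum_image (f := fun x => c x ^ 2 * wallBondProb p lam α x) hinj).symm
    _ ≤ Vc p lam α c s := by
        refine Finset.sum_le_sum_of_subset_of_nonneg (fun x hx => ?_) fun x _ _ =>
          mul_nonneg (sq_nonneg _) (wallBondProb_mem p lam α x).1
        obtain ⟨v, hv, rfl⟩ := Finset.mem_image.1 hx
        exact (Finset.mem_filter.1 hv).2

/-- **The per-vertex variance bound**: at a wall vertex `u`, `Σ_{v ∼ u} κ({u,v})² w({u,v}) ≤ 4 V_c`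
(nonnegative weights on wall types). [cite: Hutchcroft2020Locality, §3, proof of Thm. 1.6] -/
theorem star_bound (p : unitInterval) (lam α : ℝ) {c : Site 3 → ℝ} {s : Finset (Site 3)}
    (hc : ∀ x ∈ s, 0 ≤ c x) (hs : ∀ x ∈ s, x 0 = 0) (L : ℕ) {u : Site 3} (hu : u 0 = 0) :
    ∑ v ∈ (trG L).neighborFinset u, kap c s s(u, v) ^ 2 * (augProb p lam α s(u, v) : ℝ) ≤ 4 * Vc p lam α c s := by
  classical
  -- `κ({u,v}) ≤ A v + B v` with `A v = [v-u ∈ s] c_{v-u}`, `B v = [u-v ∈ s] c_{u-v}`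
  set A : Site 3 → ℝ := fun v => if v - u ∈ s then c (v - u) else 0 with hA
  set B : Site 3 → ℝ := fun v => if u - v ∈ s then c (u - v) else 0 with hB
  have hA0 : ∀ v, 0 ≤ A v := fun v => by simp only [hA]; split_ifs with h; exacts [hc _ h, le_rfl]
  have hB0 : ∀ v, 0 ≤ B v := fun v => by simp only [hB]; split_ifs with h; exacts [hc _ h, le_rfl]
  have hk : ∀ v, kap c s s(u, v) ≤ A v + B v := by
    intro v
    calc kap c s s(u, v) ≤ ∑ x ∈ s, c x * ((if v = u + x then 1 else 0) + (if u = v + x then 1 else 0)) :=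
          Finset.sum_le_sum fun x hx => mul_le_mul_of_nonneg_left (lab_mk_le u v x) (hc x hx)
      _ = A v + B v := by
          rw [Finset.sum_congr rfl (g := fun x => (if x = v - u then c x else 0) + (if x = u - v then c x else 0))
            fun x _ => by
              have e1 : (v = u + x) ↔ (x = v - u) := by rw [eq_sub_iff_add_eq', eq_comm]
              have e2 : (u = v + x) ↔ (x = u - v) := by rw [eq_sub_iff_add_eq', eq_comm]
              simp only [e1, e2, mul_add, mul_ite, mul_one, mul_zero],
            Finset.sum_add_distrib, Finset.sum_ite_eq', Finset.sum_ite_eq']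
  have hw0 : ∀ v, 0 ≤ (augProb p lam α s(u, v) : ℝ) := fun v => (augProb p lam α s(u, v)).2.1
  have hAsq : ∀ v, A v ^ 2 = if v - u ∈ s then c (v - u) ^ 2 else 0 := fun v => by
    simp only [hA]; split_ifs <;> simp
  have hBsq : ∀ v, B v ^ 2 = if u - v ∈ s then c (u - v) ^ 2 else 0 := fun v => by
    simp only [hB]; split_ifs <;> simp
  have h1 := sum_nbr_sq_le p lam α c s L hu
  have h2 := sum_nbr_sq_le' p lam α c hs L hu
  simp only [← hAsq] at h1
  simp only [← hBsq] at h2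
  calc ∑ v ∈ (trG L).neighborFinset u, kap c s s(u, v) ^ 2 * (augProb p lam α s(u, v) : ℝ)
      ≤ ∑ v ∈ (trG L).neighborFinset u, (2 * A v ^ 2 + 2 * B v ^ 2) * (augProb p lam α s(u, v) : ℝ) := by
        refine Finset.sum_le_sum fun v _ => mul_le_mul_of_nonneg_right ?_ (hw0 v)
        have := pow_le_pow_left₀ (kap_nonneg hc s(u, v)) (hk v) 2
        nlinarith [sq_nonneg (A v - B v)]
    _ = 2 * ∑ v ∈ (trG L).neighborFinset u, A v ^ 2 * (augProb p lam α s(u, v) : ℝ) +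
          2 * ∑ v ∈ (trG L).neighborFinset u, B v ^ 2 * (augProb p lam α s(u, v) : ℝ) := by
        simp only [add_mul, Finset.sum_add_distrib, Finset.mul_sum, mul_assoc]
    _ ≤ 2 * Vc p lam α c s + 2 * Vc p lam α c s := by gcongr
    _ = 4 * Vc p lam α c s := by ring

/-- **Degree bound** for the truncated step graph. [folklore] -/
theorem degree_trG_le (L : ℕ) (u : Site 3) : (trG L).degree u ≤ 6 + (2 * L + 1) ^ 3 := by
  classical
  rw [← SimpleGraph.card_neighborFinset_eq_degree]
  have hsub : (trG L).neighborFinset u ⊆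
      (zdGraph 3).neighborFinset u ∪ Finset.Icc (u - fun _ => (L : ℤ)) (u + fun _ => (L : ℤ)) := by
    intro v hv
    rw [SimpleGraph.mem_neighborFinset] at hv
    exact neighborSet_trG_subset L u hv
  refine (Finset.card_le_card hsub).trans ((Finset.card_union_le _ _).trans (add_le_add ?_ ?_))
  · rw [card_neighborFinset_zdGraph_holds u]
  · rw [Pi.card_Icc]
    have hi : ∀ i : Fin 3, (Finset.Icc ((u - fun _ => (L : ℤ) : Site 3) i) ((u + fun _ => (L : ℤ) : Site 3) i)).card =
        2 * L + 1 := by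
      intro i
      simp only [Pi.sub_apply, Pi.add_apply, Int.card_Icc]
      omega
    rw [Finset.prod_congr rfl fun i _ => hi i, Finset.prod_const, Finset.card_univ, Fintype.card_fin]

/-- The number of steps of `trG L` touching a finite set is at most `(6 + (2L+1)³)` times its size.
[folklore] -/
theorem card_edgesTouching_trG_le (L : ℕ) (K : Finset (Site 3)) :
    (edgesTouching (trG L) K).card ≤ K.card * (6 + (2 * L + 1) ^ 3) := by
  classical
  unfold edgesTouching
  calc ((K.biUnion fun x => (trG L).incidenceFinset x)).card ≤ ∑ x ∈ K, ((trG L).incidenceFinset x).card :=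
        Finset.card_biUnion_le
    _ ≤ ∑ _x ∈ K, (6 + (2 * L + 1) ^ 3) := Finset.sum_le_sum fun x _ => by
        rw [SimpleGraph.card_incidenceFinset_eq_degree]; exact degree_trG_le L x
    _ = K.card * (6 + (2 * L + 1) ^ 3) := by rw [Finset.sum_const, smul_eq_mul]


end WallTwoGhost

open WallTwoGhost in
/-- **K1, part 4 (per-vertex variance bound).** With nonnegative weights `c` on finitely many wall
types `s`, the wall bonds at one wall vertex `u` carry total squared coefficient times probability at
most `4 V_c = 4 Σ_{x∈s} c_x² q_x` — the quadratic-variation input of the wall two-ghost inequality.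
[cite: Hutchcroft2020Locality, §3, proof of Thm. 1.6] -/
theorem wallTwoGhost_star_bound : ∀ (p : unitInterval) (lam α : ℝ) (c : Site 3 → ℝ) (s : Finset (Site 3)), (∀ x ∈ s, 0 ≤ c x) → (∀ x ∈ s, x 0 = 0) → ∀ (L : ℕ) (u : Site 3), u 0 = 0 → ∑ v ∈ (trG L).neighborFinset u, kap c s s(u, v) ^ 2 * (augProb p lam α s(u, v) : ℝ) ≤ 4 * Vc p lam α c s :=
  fun p lam α _ _ hc hs L _ hu => star_bound p lam α hc hs L hu

end Summit.CriticalPhenomena.PercolationContinuityZ3.Theorems
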